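import Summits.CriticalPhenomena.PercolationContinuityZ3.Theorems.PercNearOneGluingNoHeavyLowerTailCILTwoSteinerTools
import HarnessLib

/-!
# `NoHeavyLowerTail` (stmt-CriticalPhenomena-4575) — the cumulative isolation lemma for observers with relay neighbours
# and TWO pendant relay-stars, at EVERY level (the observer series law)

Support file (prover `prim-hp-2`, deletion–contraction / pivotal-edge line; `--supports stmt-CriticalPhenomena-4575`).
No definitions, no named facts, no sorries.  Notation as in `…CILTwoSteinerTools.lean`.

THE CLASS.  The positive-weight neighbours of `o ∉ A` are relays and two further vertices `x ≠ y` (non-relays) all of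
whose other positive-weight neighbours are relays ("two pendant relay-stars"; any port sets, shared ports allowed).  For
ONE such neighbour this is `cil_oneSteiner` (prim-gen-swap; the CIL analogue of [KozmaNitzan2024, Thm 5]); two was the
first open configuration of the hull-port residual (the "two-sided core" TPS / `CS(H,{x,y})`, settled before only for
special port shapes or `j ≤ 2`: `…CILTwoPortLevelTwo`, `…CILTwoPortFewRelays`, `…CILTwoPendantStarsWitnessPair`).

THE PROOF (observer series law).
* Relay pairs at `o` are peeled exactly as in `cil_oneSteiner_of`: one-bond decomposition, the induction hypothesis for a
  champion of the DELETED graph, `CILOneSteiner.mergeStability_at_relay` for the glued branch — the class only has to be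
  closed under deleting relay pairs at `o`, and the conclusion is for EVERY champion (`cil_twoSteiner_aux`).
* Base (`CILTwoSteiner.cil_base`): `o` has only the pairs `e = s(o,x)` (weight `α`) and `f = s(o,y)` (weight `β`).  Then
  `μ_w(L_o) = α(1−β)·L₁₀ + (1−α)β·L₀₁ + αβ·L₁₁` is bilinear (`L₀₀ = 0`: `o` isolated), while every relay lightness depends
  on `(α, β)` only through the product `αβ` — `o` is a series link between `x` and `y`:
  `μ_w(R_a) = (1−αβ)·μ_{G−o}(R_a) + αβ·μ_{(G−o)[e,f↦1]}(R_a)`.  Since `α(1−β) + (1−α)β ≤ 1 − αβ`, `μ_w(L_o)` is at most the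
  larger of its values at `(α,β) = (1,αβ)` and `(αβ,1)`, where the relay law — hence the champion — is unchanged, and
  each endpoint is `CILTwoSteiner.endpoint_le` (`cil_oneSteiner` after exchanging the pair `o–y` for `x–y`).

Main results: `cil_twoSteiner` (every champion, every level), `cil_twoSteiner_exists` (the `∃ a ∈ A` shape of the
registered `stub_cumulativeIsolation` for this observer class).
-/

noncomputable section

namespace Summit.CriticalPhenomena.PercolationContinuityZ3.Theorems

open MeasureTheory Set Literature.Probability.LatticeModels Literature.Probability.Percolation
open scoped Classical BigOperators

variable {n : ℕ}

namespace CILTwoSteiner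

open CILOneSteiner ChampionStability MergeStability RelayNbhd


/-- **The observer series law (base case).**  `o ∉ A` has positive-weight pairs only to the non-relays `x ≠ y`, whose
other positive-weight neighbours are relays.  Then `μ_w(L_o) ≤ μ_w(R_c)` for every champion `c` of `w`, at every level:
`μ_w(L_o) = α(1−β)L₁₀ + (1−α)βL₀₁ + αβL₁₁ ≤ max` of its values at `(1, αβ)` and `(αβ, 1)` (as `α(1−β) + (1−α)β ≤ 1 − αβ`),
the relay law depends on `(α,β)` only through `αβ`, and each endpoint is `endpoint_le`.
[cite: KozmaNitzan2024, Thm 5 (p. 13) — CIL analogue, via `cil_oneSteiner`] -/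
theorem cil_base (w : Sym2 (Fin n) → unitInterval) (A : Finset (Fin n)) (o x y : Fin n) (j : ℕ)
    (ho : o ∉ A) (hx : x ∉ A) (hy : y ∉ A) (hxo : x ≠ o) (hyo : y ≠ o) (hxy : x ≠ y)
    (hiso : ∀ v : Fin n, v ≠ o → v ≠ x → v ≠ y → (w s(o, v) : ℝ) = 0)
    (hxN : ∀ u : Fin n, u ≠ x → u ∉ A → u ≠ o → (w s(x, u) : ℝ) = 0)
    (hyN : ∀ u : Fin n, u ≠ y → u ∉ A → u ≠ o → (w s(y, u) : ℝ) = 0)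
    (c : Fin n) (hc : c ∈ A)
    (hchamp : ∀ a ∈ A,
      (prodBernoulli w).real {ω : BondConfig (Fin n) | (A.filter fun z => ω ∈ openConn a z).card ≤ j} ≤
        (prodBernoulli w).real {ω : BondConfig (Fin n) | (A.filter fun z => ω ∈ openConn c z).card ≤ j}) :
    (prodBernoulli w).real {ω : BondConfig (Fin n) |
        1 ≤ (A.filter fun z => ω ∈ openConn o z).card ∧ (A.filter fun z => ω ∈ openConn o z).card ≤ j} ≤
      (prodBernoulli w).real {ω : BondConfig (Fin n) | (A.filter fun z => ω ∈ openConn c z).card ≤ j} := by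
  haveI : ∀ u : Sym2 (Fin n) → unitInterval, IsProbabilityMeasure (prodBernoulli u) := fun u => inferInstance
  have hyx : y ≠ x := fun h => hxy h.symm
  set w0 : Sym2 (Fin n) → unitInterval := pinW w {e : Sym2 (Fin n) | o ∈ e ∧ ¬ e.IsDiag} ∅ with hw0
  set e : Sym2 (Fin n) := s(o, x) with he
  set f : Sym2 (Fin n) := s(o, y) with hf
  have hef : e ≠ f := by rw [he, hf]; intro h; exact hxy (Sym2.congr_right.1 h)
  have hfe : f ≠ e := fun h => hef h.symm
  have hw0e : w0 e = 0 := by rw [hw0, he]; exact pinW_star_mk w hxo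
  have hw0f : w0 f = 0 := by rw [hw0, hf]; exact pinW_star_mk w hyo
  -- (B1) `w` is `G − o` with the two pairs restored
  have hw : w = Function.update (Function.update w0 e (w e)) f (w f) := by
    funext e'
    by_cases h1 : e' = f
    · rw [h1, Function.update_self]
    · rw [Function.update_of_ne h1]
      by_cases h2 : e' = e
      · rw [h2, Function.update_self]
      · rw [Function.update_of_ne h2]
        by_cases hmem : e' ∈ {e : Sym2 (Fin n) | o ∈ e ∧ ¬ e.IsDiag}
        · obtain ⟨hoe, hdiag⟩ := hmem
          obtain ⟨v, rfl⟩ : ∃ v, e' = s(o, v) := by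
            induction e' using Sym2.ind with
            | h a b =>
              rcases Sym2.mem_iff.1 hoe with rfl | rfl
              · exact ⟨b, rfl⟩
              · exact ⟨a, Sym2.eq_swap⟩
          have hvo : v ≠ o := by
            intro h; apply hdiag; rw [h]; exact Sym2.mk_isDiag_iff.2 rfl
          have hvx : v ≠ x := by intro h; apply h2; rw [h, he]
          have hvy : v ≠ y := by intro h; apply h1; rw [h, hf]
          rw [hw0, pinW_star_mk w hvo]
          exact Subtype.ext (hiso v hvo hvx hvy)
        · rw [hw0, pinW_apply_of_not_mem w ∅ hmem]
  -- corner weight functions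
  have hu_e0 : Function.update w0 e 0 = w0 := Function.update_eq_self_iff.2 hw0e.symm
  have hu_f0 : Function.update w0 f 0 = w0 := Function.update_eq_self_iff.2 hw0f.symm
  have c00 : Function.update (Function.update w0 e 0) f 0 = w0 := by rw [hu_e0, hu_f0]
  have c10 : Function.update (Function.update w0 e 1) f 0 = Function.update w0 e 1 := by
    rw [Function.update_eq_self_iff, Function.update_of_ne hfe]; exact hw0f.symm
  have c01 : Function.update (Function.update w0 e 0) f 1 = Function.update w0 f 1 := by rw [hu_e0]
  -- names for the corner values
  set Lo : Set (BondConfig (Fin n)) := {ω : BondConfig (Fin n) |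
      1 ≤ (A.filter fun z => ω ∈ openConn o z).card ∧ (A.filter fun z => ω ∈ openConn o z).card ≤ j} with hLo
  set Rc : Set (BondConfig (Fin n)) := {ω : BondConfig (Fin n) | (A.filter fun z => ω ∈ openConn c z).card ≤ j}
    with hRc
  set α : ℝ := (w e : ℝ) with hα
  set β : ℝ := (w f : ℝ) with hβ
  have hα0 : 0 ≤ α := (w e).2.1
  have hα1 : α ≤ 1 := (w e).2.2
  have hβ0 : 0 ≤ β := (w f).2.1
  have hβ1 : β ≤ 1 := (w f).2.2
  set L10 : ℝ := (prodBernoulli (Function.update w0 e 1)).real Lo with hL10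
  set L01 : ℝ := (prodBernoulli (Function.update w0 f 1)).real Lo with hL01
  set L11 : ℝ := (prodBernoulli (Function.update (Function.update w0 e 1) f 1)).real Lo with hL11
  set R0 : ℝ := (prodBernoulli w0).real Rc with hR0
  set R11 : ℝ := (prodBernoulli (Function.update (Function.update w0 e 1) f 1)).real Rc with hR11
  have hL10n : 0 ≤ L10 := measureReal_nonneg
  have hL01n : 0 ≤ L01 := measureReal_nonneg
  -- `L_o` vanishes in `G − o`
  have hL00 : (prodBernoulli w0).real Lo = 0 := by
    rw [hLo]
    refine real_L_eq_zero_of_isolated w0 A o j ho fun v hv => ?_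
    rw [hw0, pinW_star_mk w hv]; rfl
  -- bilinear expansions of `μ_w(L_o)` and `μ_w(R_a)`
  have hLexp : (prodBernoulli w).real Lo = α * (1 - β) * L10 + (1 - α) * β * L01 + α * β * L11 := by
    have h := tieLiftTwo_twoBond_decomp w0 hef (w e) (w f) Lo
    rw [← hw, c00, c10, c01, hL00] at h
    rw [h]; ring
  have hRexp : ∀ a ∈ A, (prodBernoulli w).real
      {ω : BondConfig (Fin n) | (A.filter fun z => ω ∈ openConn a z).card ≤ j} =
      (1 - α * β) * (prodBernoulli w0).real
        {ω : BondConfig (Fin n) | (A.filter fun z => ω ∈ openConn a z).card ≤ j} +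
      α * β * (prodBernoulli (Function.update (Function.update w0 e 1) f 1)).real
        {ω : BondConfig (Fin n) | (A.filter fun z => ω ∈ openConn a z).card ≤ j} := by
    intro a ha
    have h := tieLiftTwo_twoBond_decomp w0 hef (w e) (w f)
      {ω : BondConfig (Fin n) | (A.filter fun z => ω ∈ openConn a z).card ≤ j}
    rw [← hw, c00, c10, c01] at h
    have h1 : (prodBernoulli (Function.update w0 e 1)).real
        {ω : BondConfig (Fin n) | (A.filter fun z => ω ∈ openConn a z).card ≤ j} =
        (prodBernoulli w0).real {ω : BondConfig (Fin n) | (A.filter fun z => ω ∈ openConn a z).card ≤ j} := by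
      rw [hw0, he]; exact real_R_update_wzero_one w A o x a j ho hxo ha
    have h2 : (prodBernoulli (Function.update w0 f 1)).real
        {ω : BondConfig (Fin n) | (A.filter fun z => ω ∈ openConn a z).card ≤ j} =
        (prodBernoulli w0).real {ω : BondConfig (Fin n) | (A.filter fun z => ω ∈ openConn a z).card ≤ j} := by
      rw [hw0, hf]; exact real_R_update_wzero_one w A o y a j ho hyo ha
    rw [h1, h2] at h
    rw [h]; ring
  -- the product weight `ε = αβ`
  have hεmem : α * β ∈ unitInterval := unitInterval.mul_mem (w e).2 (w f).2
  set ε : unitInterval := ⟨α * β, hεmem⟩ with hε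
  have hεval : (ε : ℝ) = α * β := rfl
  -- `c` is a champion of the common relay law at `(1, ε)` / `(ε, 1)`
  have hchampE : ∀ a ∈ A,
      (1 - (ε : ℝ)) * (prodBernoulli w0).real
          {ω : BondConfig (Fin n) | (A.filter fun z => ω ∈ openConn a z).card ≤ j} +
        (ε : ℝ) * (prodBernoulli (Function.update (Function.update w0 e 1) f 1)).real
          {ω : BondConfig (Fin n) | (A.filter fun z => ω ∈ openConn a z).card ≤ j} ≤
      (1 - (ε : ℝ)) * (prodBernoulli w0).real
          {ω : BondConfig (Fin n) | (A.filter fun z => ω ∈ openConn c z).card ≤ j} +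
        (ε : ℝ) * (prodBernoulli (Function.update (Function.update w0 e 1) f 1)).real
          {ω : BondConfig (Fin n) | (A.filter fun z => ω ∈ openConn c z).card ≤ j} := by
    intro a ha
    rw [hεval, ← hRexp a ha, ← hRexp c hc]
    exact hchamp a ha
  have hcomm : Function.update (Function.update w0 f 1) e 1 = Function.update (Function.update w0 e 1) f 1 :=
    Function.update_comm hfe _ _ _
  have hchampE' : ∀ a ∈ A,
      (1 - (ε : ℝ)) * (prodBernoulli w0).real
          {ω : BondConfig (Fin n) | (A.filter fun z => ω ∈ openConn a z).card ≤ j} +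
        (ε : ℝ) * (prodBernoulli (Function.update (Function.update w0 f 1) e 1)).real
          {ω : BondConfig (Fin n) | (A.filter fun z => ω ∈ openConn a z).card ≤ j} ≤
      (1 - (ε : ℝ)) * (prodBernoulli w0).real
          {ω : BondConfig (Fin n) | (A.filter fun z => ω ∈ openConn c z).card ≤ j} +
        (ε : ℝ) * (prodBernoulli (Function.update (Function.update w0 f 1) e 1)).real
          {ω : BondConfig (Fin n) | (A.filter fun z => ω ∈ openConn c z).card ≤ j} := by
    intro a ha
    rw [hcomm]
    exact hchampE a ha
  -- the two endpoints
  have hE1 := endpoint_le w A o x y j ho hx hy hxo hyo hxy hxN hyN ε c hc hchampE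
  have hE2 := endpoint_le w A o y x j ho hy hx hyo hxo hyx hyN hxN ε c hc hchampE'
  rw [← hw0, ← he, ← hf, ← hLo, ← hRc, hεval] at hE1 hE2
  rw [hcomm] at hE2
  rw [← hL10, ← hL11, ← hR0, ← hR11] at hE1
  rw [← hL01, ← hL11, ← hR0, ← hR11] at hE2
  -- assembly
  have hkey : α * (1 - β) + (1 - α) * β ≤ 1 - α * β := by
    nlinarith [mul_nonneg (sub_nonneg.2 hα1) (sub_nonneg.2 hβ1)]
  rw [hLexp, hRc, hRexp c hc, ← hRc, ← hR0, ← hR11]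
  rcases le_total L10 L01 with h | h
  · have s1 : α * (1 - β) * L10 ≤ α * (1 - β) * L01 :=
      mul_le_mul_of_nonneg_left h (mul_nonneg hα0 (sub_nonneg.2 hβ1))
    have s2 : (α * (1 - β) + (1 - α) * β) * L01 ≤ (1 - α * β) * L01 :=
      mul_le_mul_of_nonneg_right hkey hL01n
    nlinarith [s1, s2, hE2]
  · have s1 : (1 - α) * β * L01 ≤ (1 - α) * β * L10 :=
      mul_le_mul_of_nonneg_left h (mul_nonneg (sub_nonneg.2 hα1) hβ0)
    have s2 : (α * (1 - β) + (1 - α) * β) * L10 ≤ (1 - α * β) * L10 :=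
      mul_le_mul_of_nonneg_right hkey hL10n
    nlinarith [s1, s2, hE1]

end CILTwoSteiner

open CILOneSteiner ChampionStability MergeStability RelayNbhd CILTwoSteiner

/-- **CIL for observers with relay neighbours and two pendant relay-stars — induction on the relay pairs at `o`.**
If the positive-weight neighbours of `o ∉ A` are relays and possibly the two non-relays `x ≠ y`, all of whose other
positive-weight neighbours are relays, then `μ(1 ≤ |π(o)| ≤ j) ≤ μ(|π(c)| ≤ j)` for every champion `c` of `w`, at every
level `j`.  The relay pairs at `o` are peeled as in `cil_oneSteiner_of` (champion of the deleted graph +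
`CILOneSteiner.mergeStability_at_relay`); the base is `CILTwoSteiner.cil_base`.
[cite: VandenbergHaggstromKahn2005, Thm. 1.5 (p. 7) — via `mergeStability_at_relay`; KozmaNitzan2024, Thm 5 (p. 13)] -/
theorem cil_twoSteiner_aux (A : Finset (Fin n)) (o x y : Fin n) (j : ℕ) (ho : o ∉ A) (hx : x ∉ A) (hy : y ∉ A)
    (hxo : x ≠ o) (hyo : y ≠ o) (hxy : x ≠ y) :
    ∀ (m : ℕ) (w : Sym2 (Fin n) → unitInterval),
      (A.filter fun v => 0 < (w s(o, v) : ℝ)).card = m →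
      (∀ v : Fin n, v ≠ o → v ∉ A → v ≠ x → v ≠ y → (w s(o, v) : ℝ) = 0) →
      (∀ u : Fin n, u ≠ x → u ∉ A → u ≠ o → (w s(x, u) : ℝ) = 0) →
      (∀ u : Fin n, u ≠ y → u ∉ A → u ≠ o → (w s(y, u) : ℝ) = 0) →
      ∀ c ∈ A, (∀ a ∈ A,
        (prodBernoulli w).real {ω : BondConfig (Fin n) | (A.filter fun z => ω ∈ openConn a z).card ≤ j} ≤
          (prodBernoulli w).real {ω : BondConfig (Fin n) | (A.filter fun z => ω ∈ openConn c z).card ≤ j}) →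
      (prodBernoulli w).real {ω : BondConfig (Fin n) |
          1 ≤ (A.filter fun z => ω ∈ openConn o z).card ∧ (A.filter fun z => ω ∈ openConn o z).card ≤ j} ≤
        (prodBernoulli w).real {ω : BondConfig (Fin n) | (A.filter fun z => ω ∈ openConn c z).card ≤ j} := by
  intro m
  induction m with
  | zero =>
    intro w hm hoN hxN hyN c hc hchampw
    -- no relay pair at `o`: only `s(o,x)`, `s(o,y)` may be positive
    have hrel0 : ∀ v ∈ A, (w s(o, v) : ℝ) = 0 := by
      intro v hv
      by_contra hne
      have hpos : 0 < (w s(o, v) : ℝ) := lt_of_le_of_ne (w s(o, v)).2.1 (Ne.symm hne)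
      have hmem : v ∈ (A.filter fun v => 0 < (w s(o, v) : ℝ)) := Finset.mem_filter.2 ⟨hv, hpos⟩
      rw [Finset.card_eq_zero] at hm
      rw [hm] at hmem
      exact Finset.notMem_empty v hmem
    have hiso : ∀ v : Fin n, v ≠ o → v ≠ x → v ≠ y → (w s(o, v) : ℝ) = 0 := by
      intro v hvo hvx hvy
      by_cases hvA : v ∈ A
      · exact hrel0 v hvA
      · exact hoN v hvo hvA hvx hvy
    exact cil_base w A o x y j ho hx hy hxo hyo hxy hiso hxN hyN c hc hchampw
  | succ m ih =>
    intro w hm hoN hxN hyN c hc hchampw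
    obtain ⟨v, hv⟩ := Finset.card_pos.1 (by omega : 0 < (A.filter fun v => 0 < (w s(o, v) : ℝ)).card)
    obtain ⟨hvA, hvpos⟩ := Finset.mem_filter.1 hv
    have hvo : v ≠ o := fun h => ho (h ▸ hvA)
    set e : Sym2 (Fin n) := s(o, v) with he
    set w₀ : Sym2 (Fin n) → unitInterval := Function.update w e 0 with hw₀
    set w₁ : Sym2 (Fin n) → unitInterval := Function.update w e 1 with hw₁
    have hcount : (A.filter fun u => 0 < (w₀ s(o, u) : ℝ)).card = m := by
      have hset : (A.filter fun u => 0 < (w₀ s(o, u) : ℝ)) = (A.filter fun u => 0 < (w s(o, u) : ℝ)).erase v := by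
        ext u
        simp only [Finset.mem_filter, Finset.mem_erase]
        by_cases huv : u = v
        · subst huv
          simp [hw₀, he, hvA]
        · have hne : s(o, u) ≠ e := by
            rw [he]
            intro h
            exact huv (Sym2.congr_right.1 h)
          simp [hw₀, Function.update_of_ne hne, huv]
      rw [hset, Finset.card_erase_of_mem hv, hm]
      rfl
    have hoN₀ : ∀ u : Fin n, u ≠ o → u ∉ A → u ≠ x → u ≠ y → (w₀ s(o, u) : ℝ) = 0 :=
      fun u hu huA hux huy => update_zero_apply_eq_zero w e _ (hoN u hu huA hux huy)
    have hxN₀ : ∀ u : Fin n, u ≠ x → u ∉ A → u ≠ o → (w₀ s(x, u) : ℝ) = 0 :=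
      fun u hu huA huo => update_zero_apply_eq_zero w e _ (hxN u hu huA huo)
    have hyN₀ : ∀ u : Fin n, u ≠ y → u ∉ A → u ≠ o → (w₀ s(y, u) : ℝ) = 0 :=
      fun u hu huA huo => update_zero_apply_eq_zero w e _ (hyN u hu huA huo)
    obtain ⟨c₀, hc₀, hchamp₀⟩ := exists_champion (prodBernoulli w₀) A ⟨c, hc⟩ j
    have hL₀ := ih w₀ hcount hoN₀ hxN₀ hyN₀ c₀ hc₀ hchamp₀
    have hw₀e : w₀ s(o, v) = 0 := by simp [hw₀, he]
    have hMS := mergeStability_at_relay w₀ A o v c₀ j ho hvA hc₀ hw₀e hchamp₀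
    have hw₁eq : Function.update w₀ s(o, v) 1 = w₁ := by
      rw [hw₀, hw₁, he, Function.update_idem]
    rw [hw₁eq] at hMS
    have hp0 : 0 ≤ (w e : ℝ) := (w e).2.1
    have hp1 : (w e : ℝ) ≤ 1 := (w e).2.2
    have hRc : (prodBernoulli w).real {ω : BondConfig (Fin n) | (A.filter fun z => ω ∈ openConn c₀ z).card ≤ j} ≤
        (prodBernoulli w).real {ω : BondConfig (Fin n) | (A.filter fun z => ω ∈ openConn c z).card ≤ j} :=
      hchampw c₀ hc₀
    refine le_trans ?_ hRc
    rw [stub_oneBondDecomp_k15 n w e {ω : BondConfig (Fin n) |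
        1 ≤ (A.filter fun z => ω ∈ openConn o z).card ∧ (A.filter fun z => ω ∈ openConn o z).card ≤ j},
      stub_oneBondDecomp_k15 n w e {ω : BondConfig (Fin n) |
        (A.filter fun z => ω ∈ openConn c₀ z).card ≤ j}]
    have h0 : (1 - (w e : ℝ)) * (prodBernoulli w₀).real {ω : BondConfig (Fin n) |
          1 ≤ (A.filter fun z => ω ∈ openConn o z).card ∧ (A.filter fun z => ω ∈ openConn o z).card ≤ j} ≤
        (1 - (w e : ℝ)) * (prodBernoulli w₀).real {ω : BondConfig (Fin n) |
          (A.filter fun z => ω ∈ openConn c₀ z).card ≤ j} :=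
      mul_le_mul_of_nonneg_left hL₀ (by linarith)
    have h1 : (w e : ℝ) * (prodBernoulli w₁).real {ω : BondConfig (Fin n) |
          1 ≤ (A.filter fun z => ω ∈ openConn o z).card ∧ (A.filter fun z => ω ∈ openConn o z).card ≤ j} ≤
        (w e : ℝ) * (prodBernoulli w₁).real {ω : BondConfig (Fin n) |
          (A.filter fun z => ω ∈ openConn c₀ z).card ≤ j} :=
      mul_le_mul_of_nonneg_left hMS hp0
    exact add_le_add h0 h1

/-- **CIL (all levels, every champion witness) for an observer whose positive-weight neighbours are relays and two
pendant relay-stars.**  `o ∉ A`; `x ≠ y` non-relays `≠ o`; every positive-weight neighbour of `o` other than `x, y` is a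
relay; every positive-weight neighbour of `x` and of `y` other than `o` is a relay (in particular `w s(x,y) = 0`; the port
sets of `x` and `y` are arbitrary and may overlap).  Then `μ(1 ≤ |π(o)| ≤ j) ≤ μ(|π(c)| ≤ j)` for every champion `c`
of `w`, at every level `j`.  This is the whole "two-pendant-stars" observer class of the hull-port residual (all port
shapes, all levels), by the observer series law — not via the two-pendant-stars set inequality TPS.
[cite: KozmaNitzan2024, Thm 5 (p. 13) — CIL analogue for two Steiner neighbours] -/
theorem cil_twoSteiner (w : Sym2 (Fin n) → unitInterval) (A : Finset (Fin n)) (o x y : Fin n) (j : ℕ)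
    (ho : o ∉ A) (hx : x ∉ A) (hy : y ∉ A) (hxo : x ≠ o) (hyo : y ≠ o) (hxy : x ≠ y)
    (hoN : ∀ v : Fin n, v ≠ o → v ∉ A → v ≠ x → v ≠ y → (w s(o, v) : ℝ) = 0)
    (hxN : ∀ u : Fin n, u ≠ x → u ∉ A → u ≠ o → (w s(x, u) : ℝ) = 0)
    (hyN : ∀ u : Fin n, u ≠ y → u ∉ A → u ≠ o → (w s(y, u) : ℝ) = 0)
    (c : Fin n) (hc : c ∈ A)
    (hchamp : ∀ a ∈ A,
      (prodBernoulli w).real {ω : BondConfig (Fin n) | (A.filter fun z => ω ∈ openConn a z).card ≤ j} ≤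
        (prodBernoulli w).real {ω : BondConfig (Fin n) | (A.filter fun z => ω ∈ openConn c z).card ≤ j}) :
    (prodBernoulli w).real {ω : BondConfig (Fin n) |
        1 ≤ (A.filter fun z => ω ∈ openConn o z).card ∧ (A.filter fun z => ω ∈ openConn o z).card ≤ j} ≤
      (prodBernoulli w).real {ω : BondConfig (Fin n) | (A.filter fun z => ω ∈ openConn c z).card ≤ j} :=
  cil_twoSteiner_aux A o x y j ho hx hy hxo hyo hxy _ w rfl hoN hxN hyN c hc hchamp

/-- **Two-Steiner CIL in the shape of the registered `stub_cumulativeIsolation`**: for `A` nonempty, `o ∉ A`, and two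
distinct non-relays `x, y ≠ o` such that every other positive-weight neighbour of `o`, of `x` and of `y` is a relay,
`∃ a ∈ A, μ(1 ≤ N ≤ j) ≤ μ(|π(a)| ≤ j)` at every level `j`. -/
theorem cil_twoSteiner_exists (w : Sym2 (Fin n) → unitInterval) (A : Finset (Fin n)) (o x y : Fin n) (j : ℕ)
    (hA : A.Nonempty) (ho : o ∉ A) (hx : x ∉ A) (hy : y ∉ A) (hxo : x ≠ o) (hyo : y ≠ o) (hxy : x ≠ y)
    (hoN : ∀ v : Fin n, v ≠ o → v ∉ A → v ≠ x → v ≠ y → (w s(o, v) : ℝ) = 0)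
    (hxN : ∀ u : Fin n, u ≠ x → u ∉ A → u ≠ o → (w s(x, u) : ℝ) = 0)
    (hyN : ∀ u : Fin n, u ≠ y → u ∉ A → u ≠ o → (w s(y, u) : ℝ) = 0) :
    ∃ a ∈ A, (prodBernoulli w).real {ω : BondConfig (Fin n) |
        1 ≤ (A.filter fun z => ω ∈ openConn o z).card ∧ (A.filter fun z => ω ∈ openConn o z).card ≤ j} ≤
      (prodBernoulli w).real {ω : BondConfig (Fin n) | (A.filter fun z => ω ∈ openConn a z).card ≤ j} := by
  obtain ⟨c, hc, hchamp⟩ := exists_champion (prodBernoulli w) A hA j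
  exact ⟨c, hc, cil_twoSteiner w A o x y j ho hx hy hxo hyo hxy hoN hxN hyN c hc hchamp⟩

end Summit.CriticalPhenomena.PercolationContinuityZ3.Theorems

end
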